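import Literature.NumberTheory.EllipticCurves.TowerLocalH1CartesianProofs
import HarnessLib

/-!
# Liftable classes at the bottom of a uniformly torsion `p`-power tower of `H¹`'s are the connecting images
# `δ₀(H⁰)` of the top graded piece (theorems only)

`Proofs` file (theorems only; no definition, no named fact, no instance, no `sorry`).  Companion of
`TowerLocalH1LiftExactProofs` / `TowerLocalH1CartesianProofs` (x10b-p1-w7: the cohomological inputs of Howard's H.3 for
a tower of finite discrete `Γ_F`-modules presented by ONE two-index family `f a b : W a → W b` — reductions for `b ≤ a`,
the injective `Quot(T)`-morphisms `×p^{b-a}` for `a ≤ b` — with `hid/hcomp/hsq/hinj/hsurj/hex/hpow/hkill`).  Here, for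
the SAME presentation, the input of Howard's hypothesis **H.5(b)** («the condition `F` propagated to `T̄` is stable
under `G_ℚ`», arXiv:1202.6340 p. 7 L96–97) at the places `v ∈ Σ(F)` where the local tower `H¹(K_v, T/p^j T)` is
UNIFORMLY TORSION (`p^c` kills `H¹(F, W (1+c))`; D1's (hTX) at `v ∣ N`, cell `pub/bsd-print-x9`):

* §1 free-index forms of the presentation identities (`hpow'`, `hsurj'`, `hinj'`), the composition of the upward maps
  `f b e ∘ f a b = f a e` (`a ≤ b ≤ e`, `apply_up_up`) and the free-index mixed square (`apply_up_down_comm'`).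
* §2 **`δ₀`-classes are liftable** (`exists_mem_compatibleFamilies_apply_one_eq_δ₀`): for an invariant `u` of `W 1`
  the connecting classes `δ₀^{(j)} u ∈ H¹(F, W j)` of the rows `0 → W j → W (j+1) → W 1 → 0` form a COMPATIBLE,
  `p`-torsion family (naturality of `δ₀` along the reductions); hence `δ₀^{(1)} u` lies in EVERY saturated level
  condition at level `1` (`δ₀_mem_levelCondition_one`).
* §3 **liftable classes are `δ₀`-classes of small invariants** (`exists_δ₀_eq_apply_one_of_mem_compatibleFamilies`):
  if `p^c • H¹(F, W (1+c)) = 0` then the `1`-component of a compatible family dies under `H¹(×p^c)` (`×p^c = f 1 (1+c) ∘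
  f (1+c) 1`), so is `δ₀^{(1,c)} v` for an invariant `v` of `W c` (exactness at `H¹(W 1)`); if every such invariant is
  `f 1 c u` with `P u` (hypothesis `hSB` — for the Eisenstein tower: the invariants are killed by `T^{m-1}`, and
  `W_c[T^{m-1}] ⊆ W_c[p] = p^{c-1} W_c`), then it is `δ₀^{(1,1)} u` by NATURALITY of `δ₀` along
  `(f 1 1, f 2 (1+c), f 1 c) : (0 → W 1 → W 2 → W 1 → 0) → (0 → W 1 → W (1+c) → W c → 0)`.
* §4 the resulting description `mem_levelCondition_one_iff_exists_δ₀` of the bottom level condition, for ANY cores.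

This is the «stabilisation to the top graded piece» step of H.5(b) for the saturated-unramified condition of Howard's
`F_𝔮` at the places of bad reduction (memo `HOME/x9-p1-w3/H5B-AT-S-PLAN-w3g5.md`, (L1)); seat `bsd-line-x9-p1-w3` g5.
No summit statement is proved; BSD is not proved by any of this.

References: B. Howard, Compositio Math. 140 (2004), Def. 1.1.3, H.5(b), §1.6 (arXiv:1202.6340 p. 5, p. 7 L96–97,
p. 12); J.-P. Serre, *Galois Cohomology* (1997), I §2.2; NSW (2008), (1.3.2)–(1.3.3).
-/

noncomputable section

open CategoryTheory
open scoped ContRepresentation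

universe u

namespace Literature.NumberTheory.EllipticCurves

namespace Tower

open Literature.NumberTheory.GaloisRepresentations

variable {F : Type u} [Field F]
variable {W : ℕ → Type u} [∀ j, AddCommGroup (W j)] [∀ j, TopologicalSpace (W j)]
  [∀ j, DiscreteTopology (W j)]
variable (ρ : ∀ j, DiscreteGaloisModule F (W j))
variable (f : ∀ a b, (ρ a).toContRepresentation →ⁱL (ρ b).toContRepresentation)

/-! ## §1 Free-index forms of the presentation identities -/

/-- `hpow` with free indices: `f a b (f b a w) = p^{b-a} • w` for `a ≤ b`.
[cite: Howard2004HeegnerKolyvagin, Def. 1.1.3 (arXiv p. 5, L95–97)] -/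
theorem apply_down_up_eq_pow_smul (p : ℕ) (hpow : ∀ ℓ n (w : W (ℓ + n)), f ℓ (ℓ + n) (f (ℓ + n) ℓ w) = p ^ n • w)
    {a b : ℕ} (hab : a ≤ b) (w : W b) : f a b (f b a w) = p ^ (b - a) • w := by
  obtain ⟨n, rfl⟩ := Nat.exists_eq_add_of_le hab
  rw [Nat.add_sub_cancel_left]
  exact hpow a n w

/-- `hsurj` with free indices: the reduction `f a b` (`b ≤ a`) is onto. [cite: Howard2004HeegnerKolyvagin, §2.2] -/
theorem surjective_of_le (hsurj : ∀ ℓ n, Function.Surjective (f (ℓ + n) n)) {a b : ℕ} (hba : b ≤ a) :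
    Function.Surjective (f a b) := by
  obtain ⟨n, rfl⟩ := Nat.exists_eq_add_of_le hba
  rw [Nat.add_comm]
  exact hsurj n b

/-- `hinj` with free indices: the upward map `f a b` (`a ≤ b`) is injective. [cite: Howard2004HeegnerKolyvagin, Def. 1.1.3] -/
theorem injective_of_le (hinj : ∀ ℓ n, Function.Injective (f ℓ (ℓ + n))) {a b : ℕ} (hab : a ≤ b) :
    Function.Injective (f a b) := by
  obtain ⟨n, rfl⟩ := Nat.exists_eq_add_of_le hab
  exact hinj a n

/-- Equivariance of the maps of the presentation, pointwise. [cite: SerreGaloisCohomology1997, Ch. I §2.2] -/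
theorem apply_smul_eq (a b : ℕ) (g : Field.absoluteGaloisGroup F) (w : W a) :
    f a b (ρ a g w) = ρ b g (f a b w) :=
  congrArg (fun φ ↦ φ w) ((f a b).isIntertwining' g)

/-- An element whose image under an INJECTIVE upward map is invariant is invariant.
[cite: SerreGaloisCohomology1997, Ch. I §2.2] -/
theorem mem_invariants_of_apply_mem (hinj : ∀ ℓ n, Function.Injective (f ℓ (ℓ + n))) {a b : ℕ} (hab : a ≤ b)
    (u : W a) (hu : f a b u ∈ (ρ b).toTopRep.ρ.invariants) : u ∈ (ρ a).toTopRep.ρ.invariants := fun g ↦ by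
  apply injective_of_le ρ f hinj hab
  change f a b (ρ a g u) = f a b u
  rw [apply_smul_eq ρ f a b g u]
  exact hu g

/-- **The upward maps compose**: `f b e (f a b w) = f a e w` for `a ≤ b ≤ e` (both sides send a lift-and-reduce
`f e a v` to `p^{e-a} • v`, and `f e a` is onto). [cite: Howard2004HeegnerKolyvagin, Def. 1.1.3 (Quot(T) is a category)] -/
theorem apply_up_up (hcomp : ∀ a b c, c ≤ b → b ≤ a → ∀ w : W a, f b c (f a b w) = f a c w)
    (hsurj : ∀ ℓ n, Function.Surjective (f (ℓ + n) n))
    (p : ℕ) (hpow : ∀ ℓ n (w : W (ℓ + n)), f ℓ (ℓ + n) (f (ℓ + n) ℓ w) = p ^ n • w)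
    {a b e : ℕ} (hab : a ≤ b) (hbe : b ≤ e) (w : W a) : f b e (f a b w) = f a e w := by
  obtain ⟨v, rfl⟩ := surjective_of_le ρ f hsurj (hab.trans hbe) w
  rw [apply_down_up_eq_pow_smul ρ f p hpow (hab.trans hbe), ← hcomp e b a hab hbe v,
    apply_down_up_eq_pow_smul ρ f p hpow hab, map_nsmul, apply_down_up_eq_pow_smul ρ f p hpow hbe, smul_smul,
    ← pow_add, show b - a + (e - b) = e - a by omega]

/-- **The mixed square with free indices**: for `i ≤ j ≤ j'` and `i' + j = i + j'` (so `i' - i = j' - j`),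
`f j' i' (f j j' w) = f i i' (f j i w)` — `×p^d` commutes with the reductions (`apply_up_down_comm` of
`TowerLocalH1LiftExactProofs`, re-indexed). [cite: Howard2004HeegnerKolyvagin, Def. 1.1.3 (arXiv p. 5, L95–97)] -/
theorem apply_up_down_comm' (hid : ∀ a (w : W a), f a a w = w)
    (hcomp : ∀ a b c, c ≤ b → b ≤ a → ∀ w : W a, f b c (f a b w) = f a c w)
    (hsq : ∀ a b, a ≤ b → ∀ w : W (a + 1), f a b (f (a + 1) a w) = f (b + 1) b (f (a + 1) (b + 1) w))
    {i j i' j' : ℕ} (hij : i ≤ j) (hjj' : j ≤ j') (h : i' + j = i + j') (w : W j) :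
    f j' i' (f j j' w) = f i i' (f j i w) := by
  obtain ⟨d, rfl⟩ := Nat.exists_eq_add_of_le hjj'
  obtain rfl : i' = i + d := by omega
  exact apply_up_down_comm ρ f hid hcomp hsq hij d w

/-! ## §2 The connecting classes of an invariant of `W 1` form a compatible `p`-torsion family -/

/-- **`δ₀`-classes are liftable.** For an invariant `u` of `W 1`, the connecting classes
`x j := δ₀^{(j)} u ∈ H¹(F, W j)` of the short exact rows `0 → W j → W (j+1) → W 1 → 0` form a COMPATIBLE family of the
`H¹`-tower (naturality of `δ₀` along the reductions `(f (j+1) j, f (j+2) (j+1), id)`), they are `p`-torsion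
(`p • u = 0` by `hkill`), and `x 1 = δ₀^{(1,1)} u`. [cite: Howard2004HeegnerKolyvagin, §1.6 (arXiv p. 12, L29–55) and H.5(b)]
[cite: SerreGaloisCohomology1997, Ch. I §2.2] [cite: NeukirchSchmidtWingberg2008, (1.3.3)] -/
theorem exists_mem_compatibleFamilies_apply_one_eq_δ₀
    (hcomp : ∀ a b c, c ≤ b → b ≤ a → ∀ w : W a, f b c (f a b w) = f a c w)
    (hsq : ∀ a b, a ≤ b → ∀ w : W (a + 1), f a b (f (a + 1) a w) = f (b + 1) b (f (a + 1) (b + 1) w))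
    (hinj : ∀ ℓ n, Function.Injective (f ℓ (ℓ + n)))
    (hsurj : ∀ ℓ n, Function.Surjective (f (ℓ + n) n))
    (hex : ∀ ℓ n (y : W (ℓ + n)), f (ℓ + n) n y = 0 ↔ ∃ x, f ℓ (ℓ + n) x = y)
    (p : ℕ) (hkill : ∀ j (w : W j), p ^ j • w = 0)
    (u : (ρ 1).toTopRep.ρ.invariants) :
    ∃ x ∈ compatibleFamilies (H := fun j ↦ galoisCohomology (ρ j) 1) (fun j ↦ galoisCohomology.map (f (j + 1) j) 1),
      (∀ j, p • x j = 0) ∧ x 1 = (isSES_of_exact ρ f hinj hsurj hex 1 1).δ₀ u := by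
  refine ⟨fun j ↦ (isSES_of_exact ρ f hinj hsurj hex j 1).δ₀ u, ?_, fun j ↦ ?_, rfl⟩
  · rw [mem_compatibleFamilies_iff]
    intro j
    -- naturality of `δ₀` along the reductions `(f (j+1) j, f (j+2) (j+1), id)`
    have hnat := IsSES.cohomologyMap_δ₀ (h := isSES_of_exact ρ f hinj hsurj hex (j + 1) 1)
      (h' := isSES_of_exact ρ f hinj hsurj hex j 1)
      (φ₁ := TopRep.ofHom ⟨(f (j + 1) j).toContinuousLinearMap, (f (j + 1) j).isIntertwining'⟩)
      (φ₂ := TopRep.ofHom ⟨(f (j + 1 + 1) (j + 1)).toContinuousLinearMap, (f (j + 1 + 1) (j + 1)).isIntertwining'⟩)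
      (φ₃ := 𝟙 _) (fun w ↦ (hsq j (j + 1) (Nat.le_succ j) w).symm)
      (fun w ↦ (hcomp _ _ _ (Nat.le_add_left 1 j) (Nat.le_succ _) w).symm) u
    have hu : (⟨(𝟙 (ρ 1).toTopRep : (ρ 1).toTopRep ⟶ (ρ 1).toTopRep).hom (u : W 1),
        IsSES.mem_invariants_map (g := TopRep.ofHom ⟨(f (j + 1 + 1) 1).toContinuousLinearMap,
          (f (j + 1 + 1) 1).isIntertwining'⟩) (φ₂ := TopRep.ofHom ⟨(f (j + 1 + 1) (j + 1)).toContinuousLinearMap,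
          (f (j + 1 + 1) (j + 1)).isIntertwining'⟩)
          (fun w ↦ (hcomp _ _ _ (Nat.le_add_left 1 j) (Nat.le_succ _) w).symm) u⟩ :
          (ρ 1).toTopRep.ρ.invariants) = u := Subtype.ext rfl
    rw [hu] at hnat
    rw [galoisCohomology.map_eq_cohomologyMap_apply]
    exact hnat
  · have hpu : p • u = 0 := Subtype.ext (by
      have h1 := hkill 1 (u : W 1)
      rw [pow_one] at h1
      rw [AddSubmonoidClass.coe_nsmul, ZeroMemClass.coe_zero]
      exact h1)
    exact (map_nsmul (isSES_of_exact ρ f hinj hsurj hex j 1).δ₀ p u).symm.trans (by rw [hpu, map_zero]; exact rfl)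

/-- Hence **`δ₀^{(1,1)} u` lies in every saturated level condition at level `1`** (cores arbitrary: a compatible
`p`-torsion family is saturated with `a = 1`). [cite: Howard2004HeegnerKolyvagin, Def. 1.1.1 / Def. 3.1.2 and H.5(b)] -/
theorem δ₀_mem_levelCondition_one
    (hcomp : ∀ a b c, c ≤ b → b ≤ a → ∀ w : W a, f b c (f a b w) = f a c w)
    (hsq : ∀ a b, a ≤ b → ∀ w : W (a + 1), f a b (f (a + 1) a w) = f (b + 1) b (f (a + 1) (b + 1) w))
    (hinj : ∀ ℓ n, Function.Injective (f ℓ (ℓ + n)))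
    (hsurj : ∀ ℓ n, Function.Surjective (f (ℓ + n) n))
    (hex : ∀ ℓ n (y : W (ℓ + n)), f (ℓ + n) n y = 0 ↔ ∃ x, f ℓ (ℓ + n) x = y)
    (p : ℕ) (hkill : ∀ j (w : W j), p ^ j • w = 0)
    (C : ∀ j, AddSubgroup (galoisCohomology (ρ j) 1)) (u : (ρ 1).toTopRep.ρ.invariants) :
    ((isSES_of_exact ρ f hinj hsurj hex 1 1).δ₀ u : galoisCohomology (ρ 1) 1) ∈
      levelCondition (H := fun j ↦ galoisCohomology (ρ j) 1) (fun j ↦ galoisCohomology.map (f (j + 1) j) 1) p C 1 := by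
  obtain ⟨x, hx, hxp, hx1⟩ := exists_mem_compatibleFamilies_apply_one_eq_δ₀ ρ f hcomp hsq hinj hsurj hex p hkill u
  have hx1L : x 1 ∈ levelCondition (H := fun j ↦ galoisCohomology (ρ j) 1)
      (fun j ↦ galoisCohomology.map (f (j + 1) j) 1) p C 1 :=
    (mem_levelCondition_iff _ p C 1 (x 1)).2
      ⟨x, (mem_saturatedFamilies_iff _ p C x).2 ⟨(mem_compatibleFamilies_iff _ x).1 hx, 1, fun j ↦ by
        rw [pow_one, hxp j]; exact zero_mem _⟩, rfl⟩
  exact hx1 ▸ hx1L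

/-! ## §3 Liftable classes at level `1` are `δ₀`-classes of small invariants -/

/-- **The `1`-component of a compatible family dies under `H¹(×p^c)` when `p^c • H¹(F, W (1+c)) = 0`**:
`H¹(f 1 (1+c)) (x 1) = H¹(f 1 (1+c) ∘ f (1+c) 1) (x (1+c)) = p^c • x (1+c) = 0`.
[cite: Howard2004HeegnerKolyvagin, Def. 1.1.3 and §1.6 (arXiv p. 5, p. 12)] [cite: SerreGaloisCohomology1997, Ch. I §2.2] -/
theorem map_up_apply_one_eq_zero (hid : ∀ a (w : W a), f a a w = w)
    (hcomp : ∀ a b c, c ≤ b → b ≤ a → ∀ w : W a, f b c (f a b w) = f a c w)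
    (p : ℕ) (hpow : ∀ ℓ n (w : W (ℓ + n)), f ℓ (ℓ + n) (f (ℓ + n) ℓ w) = p ^ n • w) (c : ℕ)
    (hUT : ∀ y : galoisCohomology (ρ (1 + c)) 1, p ^ c • y = 0)
    {x : Π j, galoisCohomology (ρ j) 1}
    (hx : x ∈ compatibleFamilies (H := fun j ↦ galoisCohomology (ρ j) 1) (fun j ↦ galoisCohomology.map (f (j + 1) j) 1)) :
    galoisCohomology.map (f 1 (1 + c)) 1 (x 1) = 0 := by
  rw [← map_apply_eq_of_mem ρ f hid hcomp hx (Nat.le_add_right 1 c),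
    galoisCohomology.map_map_of_comp_apply (f (1 + c) 1) (f 1 (1 + c))
      (DiscreteGaloisModule.scalarIntertwining _ (DiscreteGaloisModule.isScalarLinear_int _) ((p ^ c : ℕ) : ℤ))
      (fun w ↦ by rw [DiscreteGaloisModule.scalarIntertwining_apply, natCast_zsmul, hpow 1 c w]),
    map_natCastIntertwining_eq_nsmul]
  exact hUT _

/-- **Liftable classes are `δ₀`-classes of small invariants.**  Let `1 ≤ c`, `p^c • H¹(F, W (1+c)) = 0`, and suppose
every invariant of `W c` is `f 1 c u` for some `u ∈ W 1` with `P u` (`hSB`).  Then the `1`-component of every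
compatible family of the `H¹`-tower is `δ₀^{(1,1)} u` — the connecting class of the row `0 → W 1 → W 2 → W 1 → 0` — for an
invariant `u` of `W 1` with `P u`: exactness at `H¹(F, W 1)` of the row `0 → W 1 → W (1+c) → W c → 0` and naturality of
`δ₀` along `(f 1 1, f 2 (1+c), f 1 c)`. [cite: Howard2004HeegnerKolyvagin, H.5(b) and §1.6 (arXiv p. 7 L96–97, p. 12)]
[cite: SerreGaloisCohomology1997, Ch. I §2.2] [cite: NeukirchSchmidtWingberg2008, (1.3.2)–(1.3.3)] -/
theorem exists_δ₀_eq_apply_one_of_mem_compatibleFamilies (hid : ∀ a (w : W a), f a a w = w)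
    (hcomp : ∀ a b c, c ≤ b → b ≤ a → ∀ w : W a, f b c (f a b w) = f a c w)
    (hsq : ∀ a b, a ≤ b → ∀ w : W (a + 1), f a b (f (a + 1) a w) = f (b + 1) b (f (a + 1) (b + 1) w))
    (hinj : ∀ ℓ n, Function.Injective (f ℓ (ℓ + n)))
    (hsurj : ∀ ℓ n, Function.Surjective (f (ℓ + n) n))
    (hex : ∀ ℓ n (y : W (ℓ + n)), f (ℓ + n) n y = 0 ↔ ∃ x, f ℓ (ℓ + n) x = y)
    (p : ℕ) (hpow : ∀ ℓ n (w : W (ℓ + n)), f ℓ (ℓ + n) (f (ℓ + n) ℓ w) = p ^ n • w)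
    {c : ℕ} (hc : 1 ≤ c) (hUT : ∀ y : galoisCohomology (ρ (1 + c)) 1, p ^ c • y = 0)
    (P : W 1 → Prop) (hSB : ∀ v : W c, v ∈ (ρ c).toTopRep.ρ.invariants → ∃ u : W 1, P u ∧ f 1 c u = v)
    {x : Π j, galoisCohomology (ρ j) 1}
    (hx : x ∈ compatibleFamilies (H := fun j ↦ galoisCohomology (ρ j) 1) (fun j ↦ galoisCohomology.map (f (j + 1) j) 1)) :
    ∃ u : (ρ 1).toTopRep.ρ.invariants, P u ∧ (isSES_of_exact ρ f hinj hsurj hex 1 1).δ₀ u = x 1 := by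
  let S1c := isSES_of_exact ρ f hinj hsurj hex 1 c
  let S11 := isSES_of_exact ρ f hinj hsurj hex 1 1
  -- `x 1` dies under `H¹(×p^c)`, hence is `δ₀^{(1,c)} v`
  obtain ⟨v, hv⟩ := S1c.exists_δ₀_eq_of_map_one_eq_zero (x 1)
    (by rw [← galoisCohomology.map_eq_cohomologyMap_apply]; exact map_up_apply_one_eq_zero ρ f hid hcomp p hpow c hUT hx)
  -- the invariant `v` of `W c` is `f 1 c u`, `u` invariant with `P u`
  obtain ⟨u, hPu, huv⟩ := hSB v.1 v.2
  have hu : u ∈ (ρ 1).toTopRep.ρ.invariants :=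
    mem_invariants_of_apply_mem ρ f hinj hc u (by rw [huv]; exact v.2)
  refine ⟨⟨u, hu⟩, hPu, ?_⟩
  -- naturality of `δ₀` along `(f 1 1, f 2 (1+c), f 1 c) : S11 → S1c`
  have hnat := IsSES.cohomologyMap_δ₀ (h := S11) (h' := S1c)
    (φ₁ := TopRep.ofHom ⟨(f 1 1).toContinuousLinearMap, (f 1 1).isIntertwining'⟩)
    (φ₂ := TopRep.ofHom ⟨(f (1 + 1) (1 + c)).toContinuousLinearMap, (f (1 + 1) (1 + c)).isIntertwining'⟩)
    (φ₃ := TopRep.ofHom ⟨(f 1 c).toContinuousLinearMap, (f 1 c).isIntertwining'⟩)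
    (fun w ↦ by
      change f (1 + 1) (1 + c) (f 1 (1 + 1) w) = f 1 (1 + c) (f 1 1 w)
      rw [hid, apply_up_up ρ f hcomp hsurj p hpow (Nat.le_succ 1) (by omega) w])
    (fun w ↦ by
      change f 1 c (f (1 + 1) 1 w) = f (1 + c) c (f (1 + 1) (1 + c) w)
      exact (apply_up_down_comm' ρ f hid hcomp hsq (Nat.le_succ 1) (by omega) (by omega) w).symm) ⟨u, hu⟩
  have hφu : (⟨(TopRep.ofHom ⟨(f 1 c).toContinuousLinearMap, (f 1 c).isIntertwining'⟩ :
      (ρ 1).toTopRep ⟶ (ρ c).toTopRep).hom u, IsSES.mem_invariants_map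
        (g := TopRep.ofHom ⟨(f (1 + 1) 1).toContinuousLinearMap, (f (1 + 1) 1).isIntertwining'⟩)
        (φ₂ := TopRep.ofHom ⟨(f (1 + 1) (1 + c)).toContinuousLinearMap, (f (1 + 1) (1 + c)).isIntertwining'⟩)
        (fun w ↦ (apply_up_down_comm' ρ f hid hcomp hsq (Nat.le_succ 1) (by omega) (by omega) w).symm) ⟨u, hu⟩⟩ :
        (ρ c).toTopRep.ρ.invariants) = v := Subtype.ext huv
  rw [hφu, hv] at hnat
  rw [← hnat, ← galoisCohomology.map_eq_cohomologyMap_apply]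
  exact (map_apply_eq_self_of_forall_apply_eq (f 1 1) (hid 1) _).symm

/-! ## §4 The bottom level condition of a uniformly torsion tower -/

/-- **The bottom level condition of a uniformly torsion tower, for ANY cores**: under `p^c • H¹(F, W (1+c)) = 0`
(`1 ≤ c`) and `hSB` (every invariant of `W c` is `f 1 c u` with `P u`), a class `y ∈ H¹(F, W 1)` lies in the saturated
level condition `levelCondition red p C 1` iff `y = δ₀^{(1,1)} u` for an invariant `u` of `W 1` with `P u`.  (So the
residual images of Howard's propagated conditions at such places are computed on the top graded piece alone —
the input of H.5(b) there.) [cite: Howard2004HeegnerKolyvagin, H.5(b), Def. 1.1.1 and §1.6 (arXiv p. 5, p. 7 L96–97, p. 12)]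
[cite: SerreGaloisCohomology1997, Ch. I §2.2] -/
theorem mem_levelCondition_one_iff_exists_δ₀ (hid : ∀ a (w : W a), f a a w = w)
    (hcomp : ∀ a b c, c ≤ b → b ≤ a → ∀ w : W a, f b c (f a b w) = f a c w)
    (hsq : ∀ a b, a ≤ b → ∀ w : W (a + 1), f a b (f (a + 1) a w) = f (b + 1) b (f (a + 1) (b + 1) w))
    (hinj : ∀ ℓ n, Function.Injective (f ℓ (ℓ + n)))
    (hsurj : ∀ ℓ n, Function.Surjective (f (ℓ + n) n))
    (hex : ∀ ℓ n (y : W (ℓ + n)), f (ℓ + n) n y = 0 ↔ ∃ x, f ℓ (ℓ + n) x = y)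
    (p : ℕ) (hpow : ∀ ℓ n (w : W (ℓ + n)), f ℓ (ℓ + n) (f (ℓ + n) ℓ w) = p ^ n • w)
    (hkill : ∀ j (w : W j), p ^ j • w = 0)
    {c : ℕ} (hc : 1 ≤ c) (hUT : ∀ y : galoisCohomology (ρ (1 + c)) 1, p ^ c • y = 0)
    (P : W 1 → Prop) (hSB : ∀ v : W c, v ∈ (ρ c).toTopRep.ρ.invariants → ∃ u : W 1, P u ∧ f 1 c u = v)
    (C : ∀ j, AddSubgroup (galoisCohomology (ρ j) 1)) (y : galoisCohomology (ρ 1) 1) :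
    y ∈ levelCondition (H := fun j ↦ galoisCohomology (ρ j) 1) (fun j ↦ galoisCohomology.map (f (j + 1) j) 1) p C 1 ↔
      ∃ u : (ρ 1).toTopRep.ρ.invariants, P u ∧ (isSES_of_exact ρ f hinj hsurj hex 1 1).δ₀ u = y := by
  constructor
  · intro hy
    obtain ⟨x, hx, rfl⟩ := (mem_levelCondition_iff _ p C 1 y).1 hy
    exact exists_δ₀_eq_apply_one_of_mem_compatibleFamilies ρ f hid hcomp hsq hinj hsurj hex p hpow hc hUT P hSB
      (saturatedFamilies_le_compatibleFamilies _ p C hx)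
  · rintro ⟨u, -, rfl⟩
    exact δ₀_mem_levelCondition_one ρ f hcomp hsq hinj hsurj hex p hkill C u

end Tower

end Literature.NumberTheory.EllipticCurves

end
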